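import Literature.Analysis.FluidPDE.OseenDuhamelEnvelopeCalculus
import Literature.Analysis.UnboundedOperators.HeatKernelBoundedData
import Literature.Analysis.UnboundedOperators.HeatKernelHeatEquation
import HarnessLib

/-!
# Small planar data: the Oseen integral equation from the initial time

Route `PlaneEnergyCeiling`, crux `PlanarEnergyAPriori` (stmt-NavierStokesRegularity-16855), small-data
corner, fourth tool file. The tree's Oseen representations of classical solutions
(`mild_of_bounded_of_eLpNorm_two_le_of_lt`, KNSS 2009 Lemma 3.1) start from a POSITIVE base time
`s > a`; the bootstrap of `SmallDataBootstrap.lean` also needs the base time `0`. This file proves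
the passage to the limit `s → 0⁺` (`oseenRepr_from_zero`): for a jointly continuous field `v` on
`ℝ × ℝ³` with the uniform spatial decay `(1 + ‖x‖)³ ‖v(s,x)‖ ≤ C_d` which satisfies
`v(t) = e^{(t−s)Δ} v(s) − B_s(v,v)(t)` for all `0 < s < t ≤ S₁`, the same identity holds with `s = 0`.

Ingredients: uniform convergence `v(s) → v(0)` on `ℝ³` as `s → 0⁺` (uniform continuity on compacts
and uniformly small tails, `exists_forall_norm_sub_le_of_decay`), the `L^∞` contraction of the heat
flow, continuity of `σ ↦ e^{σΔ}v(0)` at `σ = t > 0` (`hasDerivAt_heatExtension_time`), and the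
envelope bound `‖B₀(t) − B_s(t)‖ ≤ C₀ ∫_{(0,t)∩(−∞,s]} (t−τ)^{-1/2} D²`
(`norm_oseenDuhamel_sub_oseenDuhamel_le`).

## References

* G. Koch, N. Nadirashvili, G. Seregin, V. Šverák, Acta Math. 203 (2009), §4 (arXiv:0709.3599).
  [KochNadirashviliSereginSverak2009]
-/

noncomputable section

-- single-conjunct summit: `Summit.<Summit>.<Problem>` repeats the name by the D-0017 layout
set_option linter.dupNamespace false

namespace Summit.NavierStokesRegularity.NavierStokesRegularity.Theorems.PlanarEnergyAPriori.SmallData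

open MeasureTheory Set Function Filter Topology TopologicalSpace Metric WithLp
open scoped NNReal ENNReal
open Literature.Analysis Literature.Analysis.FluidPDE

/-- **Uniform convergence `v(s) → v(0)` from joint continuity and uniform decay.** If `v` is
jointly continuous on `ℝ × ℝ³` and `(1 + ‖x‖)³ ‖v(s,x)‖ ≤ C_d` for all `s`, `x`, then for every
`ε > 0` there is `θ > 0` with `‖v(s,x) − v(0,x)‖ ≤ ε` for all `0 ≤ s ≤ θ` and all `x` (uniform
continuity on `[0,1] × B̄_ρ`, tails `≤ 2C_d (1+ρ)^{-3}`). [folklore] -/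
theorem exists_forall_norm_sub_le_of_decay {v : ℝ → EuclideanSpace ℝ (Fin 3) → EuclideanSpace ℝ (Fin 3)}
    (hvc : Continuous (uncurry v)) {Cd : ℝ} (hdec : ∀ s x, (1 + ‖x‖) ^ 3 * ‖v s x‖ ≤ Cd)
    {ε : ℝ} (hε : 0 < ε) :
    ∃ θ : ℝ, 0 < θ ∧ ∀ s ∈ Icc 0 θ, ∀ x, ‖v s x - v 0 x‖ ≤ ε := by
  have hCd : 0 ≤ Cd := le_trans (by positivity) (hdec 0 0)
  -- tails: choose `ρ` with `2 C_d ≤ (ε/2) (1 + ρ)`; then `(1+‖x‖)³ ≥ 1 + ‖x‖ ≥ 1 + ρ` handles them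
  set ρ : ℝ := 4 * Cd / ε with hρ
  have hρ0 : 0 ≤ ρ := by positivity
  have htail : ∀ s x, ρ ≤ ‖x‖ → ‖v s x‖ ≤ ε / 4 := by
    intro s x hx
    have h1 : 1 ≤ 1 + ‖x‖ := by linarith [norm_nonneg x]
    have h3 : 1 + ‖x‖ ≤ (1 + ‖x‖) ^ 3 := by
      calc 1 + ‖x‖ = (1 + ‖x‖) ^ 1 := (pow_one _).symm
        _ ≤ (1 + ‖x‖) ^ 3 := pow_le_pow_right₀ h1 (by norm_num)
    have h4 : (1 + ‖x‖) * ‖v s x‖ ≤ Cd :=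
      (mul_le_mul_of_nonneg_right h3 (norm_nonneg _)).trans (hdec s x)
    have h5 : (1 + ρ) * ‖v s x‖ ≤ Cd :=
      (mul_le_mul_of_nonneg_right (by linarith) (norm_nonneg _)).trans h4
    have h6 : ε * (1 + ρ) = ε + 4 * Cd := by rw [hρ]; field_simp
    by_contra hlt
    push Not at hlt
    have : (1 + ρ) * (ε / 4) < (1 + ρ) * ‖v s x‖ := mul_lt_mul_of_pos_left hlt (by linarith)
    nlinarith
  -- uniform continuity on the compact `[0, 1] × B̄_ρ`
  set Kc : Set (ℝ × EuclideanSpace ℝ (Fin 3)) := Icc 0 1 ×ˢ closedBall 0 ρ with hKc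
  have hKcpt : IsCompact Kc := isCompact_Icc.prod (isCompact_closedBall 0 ρ)
  have huc : UniformContinuousOn (uncurry v) Kc := hKcpt.uniformContinuousOn_of_continuous hvc.continuousOn
  obtain ⟨θ₀, hθ₀, hθ⟩ := Metric.uniformContinuousOn_iff.1 huc (ε / 2) (by positivity)
  refine ⟨min θ₀ 1 / 2, by positivity, ?_⟩
  intro s hs x
  have hs1 : s ≤ 1 := by linarith [hs.2, min_le_right θ₀ 1]
  have hsθ : s < θ₀ := by linarith [hs.2, min_le_left θ₀ 1]
  rcases le_or_gt ρ ‖x‖ with hfar | hnear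
  · calc ‖v s x - v 0 x‖ ≤ ‖v s x‖ + ‖v 0 x‖ := norm_sub_le _ _
      _ ≤ ε / 4 + ε / 4 := add_le_add (htail s x hfar) (htail 0 x hfar)
      _ ≤ ε := by linarith
  · have hxs : ((s, x) : ℝ × EuclideanSpace ℝ (Fin 3)) ∈ Kc :=
      ⟨⟨hs.1, hs1⟩, mem_closedBall_zero_iff.2 hnear.le⟩
    have hx0 : ((0, x) : ℝ × EuclideanSpace ℝ (Fin 3)) ∈ Kc :=
      ⟨⟨le_rfl, zero_le_one⟩, mem_closedBall_zero_iff.2 hnear.le⟩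
    have hdist : dist ((s, x) : ℝ × EuclideanSpace ℝ (Fin 3)) (0, x) < θ₀ := by
      rw [Prod.dist_eq, dist_self, Real.dist_eq, sub_zero, abs_of_nonneg hs.1, max_eq_left hs.1]
      exact hsθ
    have h := hθ (s, x) hxs (0, x) hx0 hdist
    rw [dist_eq_norm] at h
    have h' : ‖v s x - v 0 x‖ < ε / 2 := h
    linarith

/-- **The Oseen integral equation from the initial time.** Let `v` be jointly continuous on
`ℝ × ℝ³` with `(1 + ‖x‖)³ ‖v(s,x)‖ ≤ C_d`, and suppose `v(t) = e^{(t−s)Δ}v(s) − B_s(v,v)(t)` pointwise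
for all `0 < s < t ≤ S₁`. Then `v(t) = e^{tΔ}v(0) − B₀(v,v)(t)` pointwise for all `0 < t ≤ S₁`
(the three increments `e^{(t−s)Δ}(v(s) − v(0))`, `e^{(t−s)Δ}v(0) − e^{tΔ}v(0)`, `B₀(t) − B_s(t)`
tend to `0` as `s → 0⁺`). [cite: KochNadirashviliSereginSverak2009, §4 p. 8] -/
theorem oseenRepr_from_zero {v : ℝ → EuclideanSpace ℝ (Fin 3) → EuclideanSpace ℝ (Fin 3)}
    (hvc : Continuous (uncurry v)) {Cd : ℝ} (hdec : ∀ s x, (1 + ‖x‖) ^ 3 * ‖v s x‖ ≤ Cd) {S₁ : ℝ}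
    (hpos : ∀ s t, 0 < s → s < t → t ≤ S₁ → ∀ x,
      v t x = UnboundedOperators.heatExtension (v s) (t - s) x - oseenDuhamel 1 s v v t x)
    {t : ℝ} (ht : 0 < t) (htS : t ≤ S₁) (x : EuclideanSpace ℝ (Fin 3)) :
    v t x = UnboundedOperators.heatExtension (v 0) (t - 0) x - oseenDuhamel 1 0 v v t x := by
  set C₀ : ℝ := oseenSliceConst (EuclideanSpace ℝ (Fin 3)) with hC₀
  have hC₀pos : 0 < C₀ := oseenSliceConst_pos
  -- the crude bound `D = C_d`
  have hD : ∀ s z, ‖v s z‖ ≤ Cd := by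
    intro s z
    have h1 : (1 : ℝ) ≤ (1 + ‖z‖) ^ 3 := one_le_pow₀ (by linarith [norm_nonneg z])
    calc ‖v s z‖ = 1 * ‖v s z‖ := (one_mul _).symm
      _ ≤ (1 + ‖z‖) ^ 3 * ‖v s z‖ := mul_le_mul_of_nonneg_right h1 (norm_nonneg _)
      _ ≤ Cd := hdec s z
  have hCd : 0 ≤ Cd := (norm_nonneg _).trans (hD 0 0)
  have hvs : ∀ s, Continuous (v s) := fun s => hvc.comp (continuous_const.prodMk continuous_id)
  have hvm : Measurable (uncurry v) := hvc.measurable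
  rw [sub_zero]
  -- it suffices to show that the difference is small
  have hsmall : ∀ ε : ℝ, 0 < ε →
      ‖v t x - (UnboundedOperators.heatExtension (v 0) t x - oseenDuhamel 1 0 v v t x)‖ ≤ ε := by
    intro ε hε
    -- (1) uniform convergence of the data
    obtain ⟨θ, hθ, hunif⟩ := exists_forall_norm_sub_le_of_decay hvc hdec (by positivity : 0 < ε / 3)
    -- (2) continuity of the caloric term in time at `σ = t`
    have hcal : ContinuousAt (fun σ => UnboundedOperators.heatExtension (v 0) σ x) t :=
      (UnboundedOperators.hasDerivAt_heatExtension_time ht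
        (UnboundedOperators.memLp_top_of_continuous_of_bound (hvs 0) (hD 0)) le_top x).continuousAt
    obtain ⟨δ₁, hδ₁, hcalε⟩ := Metric.continuousAt_iff.1 hcal (ε / 3) (by positivity)
    -- (3) the size of the early Duhamel window
    set a : ℝ := (t / 2) ^ (-(1 / 2 : ℝ)) with ha
    have ha0 : 0 < a := Real.rpow_pos_of_pos (by positivity) _
    set s : ℝ := min (min θ (δ₁ / 2)) (min (t / 2) (ε / (3 * (C₀ * (Cd * Cd) * a + 1)))) with hs
    have hs0 : 0 < s := lt_min (lt_min hθ (by positivity)) (lt_min (by positivity) (by positivity))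
    have hsθ : s ≤ θ := (min_le_left _ _).trans (min_le_left _ _)
    have hsδ : s < δ₁ := lt_of_le_of_lt ((min_le_left _ _).trans (min_le_right _ _)) (by linarith)
    have hst2 : s ≤ t / 2 := (min_le_right _ _).trans (min_le_left _ _)
    have hsε : s ≤ ε / (3 * (C₀ * (Cd * Cd) * a + 1)) := (min_le_right _ _).trans (min_le_right _ _)
    have hst : s < t := by linarith
    have hts : 0 < t - s := sub_pos.2 hst
    -- the representation from `s`
    have hrepr := hpos s t hs0 hst htS x
    -- term 1: `e^{(t−s)Δ}(v(s) − v(0))`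
    have hT1 : ‖UnboundedOperators.heatExtension (v s) (t - s) x -
        UnboundedOperators.heatExtension (v 0) (t - s) x‖ ≤ ε / 3 := by
      rw [← UnboundedOperators.heatExtension_sub_of_bound (hvs s) (hvs 0) (hD s) (hD 0) hts x]
      exact UnboundedOperators.norm_heatExtension_le (fun z => hunif s ⟨hs0.le, hsθ⟩ z) hts x
    -- term 2: `e^{(t−s)Δ}v(0) − e^{tΔ}v(0)`
    have hT2 : ‖UnboundedOperators.heatExtension (v 0) (t - s) x -
        UnboundedOperators.heatExtension (v 0) t x‖ ≤ ε / 3 := by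
      have hd : dist (t - s) t < δ₁ := by
        rw [Real.dist_eq, show t - s - t = -s by ring, abs_neg, abs_of_pos hs0]
        exact hsδ
      have h := hcalε hd
      rw [dist_eq_norm] at h
      exact h.le
    -- term 3: `B₀(t) − B_s(t)`
    have hT3 : ‖oseenDuhamel 1 0 v v t x - oseenDuhamel 1 s v v t x‖ ≤ ε / 3 := by
      have henv : IntegrableOn (fun τ => (t - τ) ^ (-(1 / 2 : ℝ)) * (Cd * Cd)) (Ioo 0 t) :=
        (integrableOn_sub_rpow_Ioo (by norm_num)).mul_const _
      have h := norm_oseenDuhamel_sub_oseenDuhamel_le hs0.le hvm hvm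
        (fun τ _ y => hD τ y) (fun τ _ y => hD τ y) henv x
      refine h.trans ?_
      -- bound the window integral by `a · D² · s`
      have hsub : Ioo 0 t ∩ Iic s ⊆ Ioc 0 s := fun τ hτ => ⟨hτ.1.1, hτ.2⟩
      have hmeasA : MeasurableSet (Ioo 0 t ∩ Iic s) := measurableSet_Ioo.inter measurableSet_Iic
      have hintA : IntegrableOn (fun τ => (t - τ) ^ (-(1 / 2 : ℝ)) * (Cd * Cd)) (Ioo 0 t ∩ Iic s) :=
        henv.mono_set inter_subset_left
      have hintC : IntegrableOn (fun _ : ℝ => a * (Cd * Cd)) (Ioo 0 t ∩ Iic s) := by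
        refine integrableOn_const ?_
        exact (measure_mono hsub).trans_lt (by simp) |>.ne
      have hpt : ∀ τ ∈ Ioo 0 t ∩ Iic s, (t - τ) ^ (-(1 / 2 : ℝ)) * (Cd * Cd) ≤ a * (Cd * Cd) := by
        intro τ hτ
        have hτs : τ ≤ s := hτ.2
        have h1 : t / 2 ≤ t - τ := by linarith
        have h2 : (t - τ) ^ (-(1 / 2 : ℝ)) ≤ a :=
          Real.rpow_le_rpow_of_nonpos (by positivity) h1 (by norm_num)
        exact mul_le_mul_of_nonneg_right h2 (by positivity)
      have hvolA : (volume (Ioo 0 t ∩ Iic s)).toReal ≤ s := by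
        calc (volume (Ioo 0 t ∩ Iic s)).toReal ≤ (volume (Ioc 0 s)).toReal :=
              ENNReal.toReal_mono (by simp) (measure_mono hsub)
          _ = s := by rw [Real.volume_Ioc, sub_zero, ENNReal.toReal_ofReal hs0.le]
      calc C₀ * ∫ τ in Ioo 0 t ∩ Iic s, (t - τ) ^ (-(1 / 2 : ℝ)) * (Cd * Cd)
          ≤ C₀ * ∫ τ in Ioo 0 t ∩ Iic s, a * (Cd * Cd) :=
            mul_le_mul_of_nonneg_left (setIntegral_mono_on hintA hintC hmeasA hpt) hC₀pos.le
        _ = C₀ * ((volume (Ioo 0 t ∩ Iic s)).toReal * (a * (Cd * Cd))) := by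
            rw [setIntegral_const, smul_eq_mul, measureReal_def]
        _ ≤ C₀ * (s * (a * (Cd * Cd))) := by gcongr
        _ = (C₀ * (Cd * Cd) * a) * s := by ring
        _ ≤ (C₀ * (Cd * Cd) * a) * (ε / (3 * (C₀ * (Cd * Cd) * a + 1))) :=
            mul_le_mul_of_nonneg_left hsε (by positivity)
        _ ≤ ε / 3 := by
            rw [mul_div_assoc', div_le_div_iff₀ (by positivity) three_pos]
            nlinarith [mul_nonneg (mul_nonneg hC₀pos.le (mul_nonneg hCd hCd)) ha0.le, hε.le]
    -- assemble
    have heq : v t x - (UnboundedOperators.heatExtension (v 0) t x - oseenDuhamel 1 0 v v t x) =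
        (UnboundedOperators.heatExtension (v s) (t - s) x - UnboundedOperators.heatExtension (v 0) (t - s) x) +
        (UnboundedOperators.heatExtension (v 0) (t - s) x - UnboundedOperators.heatExtension (v 0) t x) +
        (oseenDuhamel 1 0 v v t x - oseenDuhamel 1 s v v t x) := by
      rw [hrepr]; abel
    rw [heq]
    calc ‖(UnboundedOperators.heatExtension (v s) (t - s) x - UnboundedOperators.heatExtension (v 0) (t - s) x) +
          (UnboundedOperators.heatExtension (v 0) (t - s) x - UnboundedOperators.heatExtension (v 0) t x) +
          (oseenDuhamel 1 0 v v t x - oseenDuhamel 1 s v v t x)‖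
        ≤ ‖UnboundedOperators.heatExtension (v s) (t - s) x - UnboundedOperators.heatExtension (v 0) (t - s) x‖ +
          ‖UnboundedOperators.heatExtension (v 0) (t - s) x - UnboundedOperators.heatExtension (v 0) t x‖ +
          ‖oseenDuhamel 1 0 v v t x - oseenDuhamel 1 s v v t x‖ := norm_add₃_le
      _ ≤ ε / 3 + ε / 3 + ε / 3 := add_le_add (add_le_add hT1 hT2) hT3
      _ = ε := by ring
  have h0 : ‖v t x - (UnboundedOperators.heatExtension (v 0) t x - oseenDuhamel 1 0 v v t x)‖ ≤ 0 :=
    le_of_forall_pos_le_add fun ε hε => by rw [zero_add]; exact hsmall ε hε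
  exact sub_eq_zero.1 (norm_le_zero_iff.1 h0)

/-! ### Registered form -/

/-- **The Oseen integral equation from the initial time, closed form** (registered sub-goal of
stmt-NavierStokesRegularity-16855): the statement of `oseenRepr_from_zero` for an explicitly
quantified field. [cite: KochNadirashviliSereginSverak2009, §4 p. 8] -/
theorem oseenRepr_from_zero_closedForm :
    ∀ (v : ℝ → EuclideanSpace ℝ (Fin 3) → EuclideanSpace ℝ (Fin 3)), Continuous (Function.uncurry v) →
      ∀ (Cd : ℝ), (∀ s x, (1 + ‖x‖) ^ 3 * ‖v s x‖ ≤ Cd) → ∀ (S₁ : ℝ),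
      (∀ s t, 0 < s → s < t → t ≤ S₁ → ∀ x,
        v t x = Literature.Analysis.UnboundedOperators.heatExtension (v s) (t - s) x -
          Literature.Analysis.FluidPDE.oseenDuhamel 1 s v v t x) →
      ∀ (t : ℝ), 0 < t → t ≤ S₁ → ∀ x,
        v t x = Literature.Analysis.UnboundedOperators.heatExtension (v 0) (t - 0) x -
          Literature.Analysis.FluidPDE.oseenDuhamel 1 0 v v t x :=
  fun _ hvc _ hdec _ hpos _ ht htS x => oseenRepr_from_zero hvc hdec hpos ht htS x

end Summit.NavierStokesRegularity.NavierStokesRegularity.Theorems.PlanarEnergyAPriori.SmallData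

end
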